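import Summits.AnomalousDissipation.AnomalousDissipation.Theorems.BaireTransferDenseLoudDesignerForcesLine

/-!
# Stub `stub_goodDrift` of the line `galilean-detuning-body-force-grid`
# (crux stmt-AnomalousDissipation-1143, `BaireTransfer.DenseLoudDesignerForces`)

For every finite stock `S ⊆ ℤ³` there are constants `κ, c₀ > 0` such that GOOD DRIFTS
(`goodDrifts S κ c₀`: non-zero `n ∈ ℤ³` that are uniformly non-resonant with every non-zero
`k ∈ S`, `|k·n| ≥ κ‖k‖‖n‖`, and whose resonant sublattice is well rounded, `‖k‖² ≥ c₀‖n‖` for every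
non-zero integer `k ⊥ n`) exist with arbitrarily large norm.  This is hypothesis `hdrift` of
`DenseLoudDesignerForces_of` / `isWindow_glue` in the Line module
`Theorems/BaireTransferDenseLoudDesignerForcesLine.lean`.

Elementary proof (no lattice-basis theory; no definitions are introduced).  Let
`B := ∑_{k ∈ S} ∑ᵢ |kᵢ|` and `L := 2B + 1`, so that every `k ∈ S` has digits `2|kᵢ| < L`; by base-`L`
uniqueness `k·(1, L, L²) ≠ 0` for `k ∈ S ∖ {0}` (`baseL_zero`).  The drifts are
`n_a := (a², a²L + a, a²L² + 1) = a²(1, L, L²) + a e₁ + e₂` (`a ∈ ℤ` large), so that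
`k·n_a = a²(k·(1, L, L²)) + a k₁ + k₂` (`dot_drift`).  Hence, for `a ≥ 2B + 2`,
* non-resonance: `|k·n_a| ≥ a² - aB - B ≥ a²/2` for `k ∈ S ∖ {0}` (`sq_le_two_abs`), while
  `‖k‖‖n_a‖ ≤ (3B + 1) · a²(L² + L + 3)`;
* resonant sublattice: if `k ≠ 0` and `k·n_a = 0` then `a ≤ 2|k₁|` or `a ≤ 2|k₂|`
  (`le_two_abs_or`), so `‖k‖² ≥ a²/4 ≥ ‖n_a‖ / (4(L² + L + 3))`;
* size: `‖n_a‖ ≥ a² ≥ a`.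
So `κ := 1/(2(3B+1)(L²+L+3))` and `c₀ := 1/(4(L²+L+3))` work for every `N` (take
`a := max N (2B+2)`).  All resonance arithmetic is done over `ℤ`; only the final comparisons are cast
to `ℝ` (`inner_latticeVec`).

References: the Line module `Theorems/BaireTransferDenseLoudDesignerForcesLine.lean` (`goodDrifts`,
`DenseLoudDesignerForces_of`); Frisch, *Turbulence* (1995) §5.2 (grid turbulence behind a moving
grid); the line card `Cruxes/DenseLoudDesignerForces/Lines/galilean-detuning-body-force-grid.md`.
-/

-- `Summit.<Summit>.<Problem>` is the tree's mandated summit-side namespace (CONVENTIONS §2); for this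
-- single-conjunct summit the two coincide, so the duplicate is deliberate.
set_option linter.dupNamespace false

noncomputable section

open scoped BigOperators Topology InnerProductSpace
open Filter Set Function MeasureTheory

-- sub-namespace of the Line vocabulary namespace, so `sweptForce`, `boost`, `goodDrifts`, … resolve unqualified
namespace Summit.AnomalousDissipation.AnomalousDissipation.Theorems.DenseLoudDesignerForces.Galilean.GoodDrift

open Literature.Analysis.FunctionSpaces Literature.Analysis.FluidPDE
open Summit.AnomalousDissipation.AnomalousDissipation.Theses.BaireTransfer
open Summit.AnomalousDissipation.AnomalousDissipation.Theorems.DenseLoudDesignerForces.Negative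

/-- The flat unit torus `T³`. -/
local notation "𝕋³" => UnitAddTorus (Fin 3)
/-- Real velocity values. -/
local notation "ℝ³" => EuclideanSpace ℝ (Fin 3)
/-- Complex Fourier coefficient values. -/
local notation "ℂ³" => EuclideanSpace ℂ (Fin 3)
/-- The frequency / drift lattice `ℤ³`. -/
local notation "ℤ³" => Fin 3 → ℤ

/-! ## §1 Integer arithmetic -/

/-- A vector of `ℤ³` with vanishing coordinates vanishes. [folklore] -/
theorem eq_zero_of_coords {k : ℤ³} (h0 : k 0 = 0) (h1 : k 1 = 0) (h2 : k 2 = 0) : k = 0 := by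
  funext i
  fin_cases i
  · exact h0
  · exact h1
  · exact h2

/-- One base-`L` digit step: `x + L w = 0` with `2|x| < L` forces `w = 0` and `x = 0`. [folklore] -/
theorem digit_step {L x w : ℤ} (hL : 0 ≤ L) (hx : 2 * |x| < L) (h : x + L * w = 0) :
    w = 0 ∧ x = 0 := by
  have hw : w = 0 := by
    by_contra hw
    have h1 : (1 : ℤ) ≤ |w| := Int.one_le_abs hw
    have h2 : |x| = L * |w| := by
      rw [show x = -(L * w) by linear_combination h, abs_neg, abs_mul, abs_of_nonneg hL]
    have h3 : L * 1 ≤ L * |w| := mul_le_mul_of_nonneg_left h1 hL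
    have h4 : 0 ≤ |x| := abs_nonneg x
    linarith
  subst hw
  exact ⟨rfl, by simpa using h⟩

/-- Base-`L` uniqueness of the expansion of zero: if `x + L y + L² z = 0` with digits `2|x|, 2|y| < L`
then `x = y = z = 0`. [folklore] -/
theorem baseL_zero {L x y z : ℤ} (hL : 0 ≤ L) (hx : 2 * |x| < L) (hy : 2 * |y| < L)
    (h : x + L * y + L ^ 2 * z = 0) : x = 0 ∧ y = 0 ∧ z = 0 := by
  have h1 : x + L * (y + L * z) = 0 := by linear_combination h
  obtain ⟨hw, hx0⟩ := digit_step hL hx h1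
  obtain ⟨hz0, hy0⟩ := digit_step hL hy hw
  exact ⟨hx0, hy0, hz0⟩

/-- Non-resonance arithmetic: if `|x| ≥ 1`, `|y|, |z| ≤ B` and `a ≥ 2B + 2` then
`a² ≤ 2 |a² x + a y + z|`. [folklore] -/
theorem sq_le_two_abs {a B x y z : ℤ} (hB : 0 ≤ B) (ha : 2 * B + 2 ≤ a) (hx : 1 ≤ |x|)
    (hy : |y| ≤ B) (hz : |z| ≤ B) : a ^ 2 ≤ 2 * |a ^ 2 * x + a * y + z| := by
  have ha0 : 0 ≤ a := by linarith
  have h1 : |a ^ 2 * x| ≤ |a ^ 2 * x + a * y + z| + |a * y| + |z| := by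
    have h := abs_add_three (a ^ 2 * x + a * y + z) (-(a * y)) (-z)
    rwa [abs_neg, abs_neg, show a ^ 2 * x + a * y + z + -(a * y) + -z = a ^ 2 * x by ring] at h
  have h2 : a ^ 2 * 1 ≤ a ^ 2 * |x| := mul_le_mul_of_nonneg_left hx (sq_nonneg a)
  have h3 : |a ^ 2 * x| = a ^ 2 * |x| := by rw [abs_mul, abs_of_nonneg (sq_nonneg a)]
  have h4 : |a * y| ≤ a * B := by
    rw [abs_mul, abs_of_nonneg ha0]
    exact mul_le_mul_of_nonneg_left hy ha0
  have h5 : (2 * B + 2) * a ≤ a * a := mul_le_mul_of_nonneg_right ha ha0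
  nlinarith

/-- Resonance arithmetic: if `a ≥ 1` and `a² x + a y + z = 0` with `(x, y, z) ≠ 0` then
`a ≤ 2|y|` or `a ≤ 2|z|`. [folklore] -/
theorem le_two_abs_or {a x y z : ℤ} (ha : 1 ≤ a) (h : a ^ 2 * x + a * y + z = 0)
    (hne : ¬(x = 0 ∧ y = 0 ∧ z = 0)) : a ≤ 2 * |y| ∨ a ≤ 2 * |z| := by
  rcases le_or_gt a (2 * |y|) with hy | hy
  · exact Or.inl hy
  rcases le_or_gt a (2 * |z|) with hz | hz
  · exact Or.inr hz
  exfalso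
  have ha0 : 0 ≤ a := by linarith
  by_cases hx : x = 0
  · subst hx
    by_cases hy0 : y = 0
    · subst hy0
      exact hne ⟨rfl, rfl, by simpa using h⟩
    · have h1 : (1 : ℤ) ≤ |y| := Int.one_le_abs hy0
      have h2 : |z| = a * |y| := by
        rw [show z = -(a * y) by linear_combination h, abs_neg, abs_mul, abs_of_nonneg ha0]
      have h3 : a * 1 ≤ a * |y| := mul_le_mul_of_nonneg_left h1 ha0
      have h4 : 0 ≤ |y| := abs_nonneg y
      linarith
  · have h1 : (1 : ℤ) ≤ |x| := Int.one_le_abs hx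
    have h2 : a ^ 2 * |x| ≤ a * |y| + |z| := by
      have e : |a ^ 2 * x| = |a * y + z| := by
        rw [show a ^ 2 * x = -(a * y + z) by linear_combination h, abs_neg]
      rw [abs_mul, abs_of_nonneg (sq_nonneg a)] at e
      rw [e]
      calc |a * y + z| ≤ |a * y| + |z| := abs_add_le _ _
        _ = a * |y| + |z| := by rw [abs_mul, abs_of_nonneg ha0]
    have h3 : a ^ 2 * 1 ≤ a ^ 2 * |x| := mul_le_mul_of_nonneg_left h1 (sq_nonneg a)
    have h4 : a * (2 * |y|) ≤ a * (a - 1) := mul_le_mul_of_nonneg_left (by linarith) ha0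
    nlinarith

/-! ## §2 From `ℤ³` to `ℝ³` -/

/-- The inner product of lattice vectors is the (cast) integer dot product. [folklore] -/
theorem inner_latticeVec (k n : ℤ³) :
    ⟪Torus.latticeVec k, Torus.latticeVec n⟫_ℝ = ((k 0 * n 0 + k 1 * n 1 + k 2 * n 2 : ℤ) : ℝ) := by
  simp only [PiLp.inner_apply, RCLike.inner_apply, conj_trivial, Fin.sum_univ_three,
    Torus.latticeVec_apply]
  push_cast
  ring

/-- Each integer coordinate is bounded by the Euclidean norm. [folklore] -/
theorem abs_cast_apply_le_norm (k : ℤ³) (i : Fin 3) :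
    |((k i : ℤ) : ℝ)| ≤ ‖Torus.latticeVec k‖ := by
  have h := PiLp.norm_apply_le (Torus.latticeVec k) i
  rwa [Torus.latticeVec_apply, Real.norm_eq_abs] at h

/-- `ℓ² ≤ ℓ¹`: the Euclidean norm of a lattice vector is at most the sum of its digits. [folklore] -/
theorem norm_latticeVec_le (k : ℤ³) :
    ‖Torus.latticeVec k‖ ≤ |((k 0 : ℤ) : ℝ)| + |((k 1 : ℤ) : ℝ)| + |((k 2 : ℤ) : ℝ)| := by
  have h : Torus.latticeVec k = ∑ j, ((k j : ℤ) : ℝ) • EuclideanSpace.single j (1 : ℝ) := rfl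
  rw [h]
  refine (norm_sum_le _ _).trans (le_of_eq ?_)
  simp only [norm_smul, Real.norm_eq_abs, PiLp.norm_single, abs_one, mul_one, Fin.sum_univ_three]

/-- Every digit of a stock frequency is at most the digit budget `∑_{k ∈ S} ∑ᵢ |kᵢ|` of the stock.
[folklore] -/
theorem abs_apply_le_budget {S : Finset ℤ³} {k : ℤ³} (hk : k ∈ S) (i : Fin 3) :
    |k i| ≤ ((∑ l ∈ S, ∑ j, (l j).natAbs : ℕ) : ℤ) := by
  have h1 : (k i).natAbs ≤ ∑ j, (k j).natAbs :=
    Finset.single_le_sum (f := fun j => (k j).natAbs) (fun _ _ => Nat.zero_le _) (Finset.mem_univ i)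
  have h2 : ∑ j, (k j).natAbs ≤ ∑ l ∈ S, ∑ j, (l j).natAbs :=
    Finset.single_le_sum (f := fun l : ℤ³ => ∑ j, (l j).natAbs) (fun _ _ => Nat.zero_le _) hk
  have h3 : ((k i).natAbs : ℤ) ≤ ((∑ l ∈ S, ∑ j, (l j).natAbs : ℕ) : ℤ) := by
    exact_mod_cast h1.trans h2
  rwa [Int.natCast_natAbs] at h3

/-! ## §3 The drifts `n_a = (a², a²L + a, a²L² + 1)` -/

/-- Expansion of `k · n_a = a² (k · (1, L, L²)) + a k₁ + k₂`. [folklore] -/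
theorem dot_drift (k : ℤ³) {L a : ℤ} {n : ℤ³} (hn0 : n 0 = a ^ 2) (hn1 : n 1 = a ^ 2 * L + a)
    (hn2 : n 2 = a ^ 2 * L ^ 2 + 1) :
    k 0 * n 0 + k 1 * n 1 + k 2 * n 2 = a ^ 2 * (k 0 + L * k 1 + L ^ 2 * k 2) + a * k 1 + k 2 := by
  rw [hn0, hn1, hn2]
  ring

/-- The drift is non-zero (its first coordinate is `a² ≠ 0`). [folklore] -/
theorem drift_ne_zero {a : ℤ} {n : ℤ³} (ha : 1 ≤ a) (hn0 : n 0 = a ^ 2) : n ≠ 0 := by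
  intro h
  have h0 := congrFun h 0
  rw [hn0, Pi.zero_apply] at h0
  have : 0 < a ^ 2 := pow_pos (by linarith) 2
  linarith

/-- Size from above: `‖n_a‖ ≤ a² (L² + L + 3)` for `a ≥ 1`, `L ≥ 0`. [folklore] -/
theorem norm_drift_le {L a : ℤ} {n : ℤ³} (hL : 0 ≤ L) (ha : 1 ≤ a) (hn0 : n 0 = a ^ 2)
    (hn1 : n 1 = a ^ 2 * L + a) (hn2 : n 2 = a ^ 2 * L ^ 2 + 1) :
    ‖Torus.latticeVec n‖ ≤ (a : ℝ) ^ 2 * (((L : ℤ) : ℝ) ^ 2 + ((L : ℤ) : ℝ) + 3) := by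
  have hLr : (0 : ℝ) ≤ L := by exact_mod_cast hL
  have har : (1 : ℝ) ≤ a := by exact_mod_cast ha
  have ha0 : (0 : ℝ) ≤ a := by linarith
  refine (norm_latticeVec_le _).trans ?_
  have h0 : ((n 0 : ℤ) : ℝ) = (a : ℝ) ^ 2 := by simp [hn0]
  have h1 : ((n 1 : ℤ) : ℝ) = (a : ℝ) ^ 2 * L + a := by simp [hn1]
  have h2 : ((n 2 : ℤ) : ℝ) = (a : ℝ) ^ 2 * (L : ℝ) ^ 2 + 1 := by simp [hn2]
  rw [h0, h1, h2, abs_of_nonneg (by positivity : (0 : ℝ) ≤ (a : ℝ) ^ 2),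
    abs_of_nonneg (by positivity : (0 : ℝ) ≤ (a : ℝ) ^ 2 * L + a),
    abs_of_nonneg (by positivity : (0 : ℝ) ≤ (a : ℝ) ^ 2 * (L : ℝ) ^ 2 + 1)]
  have h3 : (1 : ℝ) ≤ (a : ℝ) ^ 2 := by nlinarith
  have h4 : (a : ℝ) ≤ (a : ℝ) ^ 2 := by nlinarith
  nlinarith

/-- Size from below: `a² ≤ ‖n_a‖`. [folklore] -/
theorem sq_le_norm_drift {a : ℤ} {n : ℤ³} (hn0 : n 0 = a ^ 2) :
    (a : ℝ) ^ 2 ≤ ‖Torus.latticeVec n‖ := by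
  have h := abs_cast_apply_le_norm n 0
  rw [hn0] at h
  push_cast at h
  rwa [abs_of_nonneg (sq_nonneg _)] at h

/-! ## §4 The two clauses of `goodDrifts` for the drifts -/

/-- NON-RESONANCE: for `k ≠ 0` with digits `|kᵢ| ≤ B`, `L = 2B + 1` and `a ≥ 2B + 2`,
`|k · n_a| ≥ a²/2`. [folklore] -/
theorem sq_div_two_le_abs_inner {B a : ℤ} {k n : ℤ³} (hB : 0 ≤ B) (ha : 2 * B + 2 ≤ a)
    (hk : ∀ i, |k i| ≤ B) (hk0 : k ≠ 0) (hn0 : n 0 = a ^ 2)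
    (hn1 : n 1 = a ^ 2 * (2 * B + 1) + a) (hn2 : n 2 = a ^ 2 * (2 * B + 1) ^ 2 + 1) :
    (a : ℝ) ^ 2 / 2 ≤ |⟪Torus.latticeVec k, Torus.latticeVec n⟫_ℝ| := by
  rw [inner_latticeVec, ← Int.cast_abs]
  have hx : (1 : ℤ) ≤ |k 0 + (2 * B + 1) * k 1 + (2 * B + 1) ^ 2 * k 2| := by
    refine Int.one_le_abs fun h => hk0 ?_
    have hL0 : (0 : ℤ) ≤ 2 * B + 1 := by linarith
    have h0 : 2 * |k 0| < 2 * B + 1 := by linarith [hk 0]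
    have h1 : 2 * |k 1| < 2 * B + 1 := by linarith [hk 1]
    obtain ⟨e0, e1, e2⟩ := baseL_zero hL0 h0 h1 h
    exact eq_zero_of_coords e0 e1 e2
  have key : a ^ 2 ≤ 2 * |k 0 * n 0 + k 1 * n 1 + k 2 * n 2| := by
    rw [dot_drift k hn0 hn1 hn2]
    exact sq_le_two_abs hB ha hx (hk 1) (hk 2)
  have key' : ((a : ℤ) : ℝ) ^ 2 ≤ 2 * ((|k 0 * n 0 + k 1 * n 1 + k 2 * n 2| : ℤ) : ℝ) := by
    exact_mod_cast key
  linarith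

/-- RESONANT SUBLATTICE: for `k ≠ 0` with `k · n_a = 0` and `a ≥ 1`, `‖k‖² ≥ a²/4`. [folklore] -/
theorem sq_div_four_le_norm_sq {L a : ℤ} {k n : ℤ³} (ha : 1 ≤ a) (hk0 : k ≠ 0)
    (hn0 : n 0 = a ^ 2) (hn1 : n 1 = a ^ 2 * L + a) (hn2 : n 2 = a ^ 2 * L ^ 2 + 1)
    (h : ⟪Torus.latticeVec k, Torus.latticeVec n⟫_ℝ = 0) :
    (a : ℝ) ^ 2 / 4 ≤ ‖Torus.latticeVec k‖ ^ 2 := by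
  rw [inner_latticeVec] at h
  have h' : k 0 * n 0 + k 1 * n 1 + k 2 * n 2 = 0 := by exact_mod_cast h
  rw [dot_drift k hn0 hn1 hn2] at h'
  have hne : ¬(k 0 + L * k 1 + L ^ 2 * k 2 = 0 ∧ k 1 = 0 ∧ k 2 = 0) := by
    rintro ⟨e, e1, e2⟩
    rw [e1, e2, mul_zero, mul_zero, add_zero, add_zero] at e
    exact hk0 (eq_zero_of_coords e e1 e2)
  have ha0 : (0 : ℝ) ≤ a := by exact_mod_cast (zero_le_one.trans ha)
  have hnn : 0 ≤ ‖Torus.latticeVec k‖ := norm_nonneg _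
  rcases le_two_abs_or ha h' hne with hi | hi
  · have h1 : (a : ℝ) ≤ 2 * |((k 1 : ℤ) : ℝ)| := by exact_mod_cast hi
    have h2 := abs_cast_apply_le_norm k 1
    have h3 : (a : ℝ) ≤ 2 * ‖Torus.latticeVec k‖ := h1.trans (by linarith)
    have h4 : (a : ℝ) * a ≤ (2 * ‖Torus.latticeVec k‖) * (2 * ‖Torus.latticeVec k‖) :=
      mul_le_mul h3 h3 ha0 (by positivity)
    nlinarith
  · have h1 : (a : ℝ) ≤ 2 * |((k 2 : ℤ) : ℝ)| := by exact_mod_cast hi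
    have h2 := abs_cast_apply_le_norm k 2
    have h3 : (a : ℝ) ≤ 2 * ‖Torus.latticeVec k‖ := h1.trans (by linarith)
    have h4 : (a : ℝ) * a ≤ (2 * ‖Torus.latticeVec k‖) * (2 * ‖Torus.latticeVec k‖) :=
      mul_le_mul h3 h3 ha0 (by positivity)
    nlinarith

/-! ## §5 The stub -/

/-- **Stub `stub_goodDrift`** (hypothesis `hdrift` of `DenseLoudDesignerForces_of`): for every finite
stock `S` there are `κ, c₀ > 0` such that good drifts `n ∈ goodDrifts S κ c₀` of arbitrarily large
norm exist.  Constants: `κ = 1/(2(3B+1)P)`, `c₀ = 1/(4P)` with `B = ∑_{k ∈ S} ∑ᵢ |kᵢ|`, `L = 2B+1`,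
`P = L² + L + 3`; drifts `n_a = (a², a²L + a, a²L² + 1)`, `a = max N (2B+2)`. [folklore] -/
theorem stub_goodDrift : ∀ S : Finset ℤ³, ∃ κ : ℝ, 0 < κ ∧ ∃ c₀ : ℝ, 0 < c₀ ∧ ∀ N : ℕ, ∃ n : ℤ³, n ∈ goodDrifts S κ c₀ ∧ (N : ℝ) ≤ ‖Torus.latticeVec n‖ := by
  intro S
  -- the digit budget `B` of the stock
  obtain ⟨B, hB, hBk⟩ : ∃ B : ℤ, 0 ≤ B ∧ ∀ k ∈ S, ∀ i, |k i| ≤ B :=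
    ⟨((∑ l ∈ S, ∑ j, (l j).natAbs : ℕ) : ℤ), by positivity, fun k hk i => abs_apply_le_budget hk i⟩
  have hBr : (0 : ℝ) ≤ B := by exact_mod_cast hB
  -- a uniform bound `M` on the norms of the stock frequencies
  obtain ⟨M, hM, hMk⟩ : ∃ M : ℝ, 0 < M ∧ ∀ k ∈ S, ‖Torus.latticeVec k‖ ≤ M := by
    refine ⟨3 * (B : ℝ) + 1, by positivity, fun k hk => ?_⟩
    have h0 : |((k 0 : ℤ) : ℝ)| ≤ B := by exact_mod_cast hBk k hk 0
    have h1 : |((k 1 : ℤ) : ℝ)| ≤ B := by exact_mod_cast hBk k hk 1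
    have h2 : |((k 2 : ℤ) : ℝ)| ≤ B := by exact_mod_cast hBk k hk 2
    linarith [norm_latticeVec_le k]
  -- the size constant `P = L² + L + 3` of the drifts, `L = 2B + 1`
  have hL : (0 : ℤ) ≤ 2 * B + 1 := by linarith
  obtain ⟨P, hP, hPn⟩ : ∃ P : ℝ, 0 < P ∧ ∀ (a : ℤ) (n : ℤ³), 1 ≤ a → n 0 = a ^ 2 →
      n 1 = a ^ 2 * (2 * B + 1) + a → n 2 = a ^ 2 * (2 * B + 1) ^ 2 + 1 →
      ‖Torus.latticeVec n‖ ≤ (a : ℝ) ^ 2 * P := by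
    have hLr : (0 : ℝ) ≤ ((2 * B + 1 : ℤ) : ℝ) := by exact_mod_cast hL
    exact ⟨_, by positivity, fun a n ha hn0 hn1 hn2 => norm_drift_le hL ha hn0 hn1 hn2⟩
  refine ⟨1 / (2 * M * P), by positivity, 1 / (4 * P), by positivity, fun N => ?_⟩
  -- the scale `a = max N (2B + 2)` and the drift `n = n_a`
  obtain ⟨a, haN, haB⟩ : ∃ a : ℤ, (N : ℤ) ≤ a ∧ 2 * B + 2 ≤ a :=
    ⟨max (N : ℤ) (2 * B + 2), le_max_left _ _, le_max_right _ _⟩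
  have ha1 : 1 ≤ a := by linarith
  obtain ⟨n, hn0, hn1, hn2⟩ : ∃ n : ℤ³, n 0 = a ^ 2 ∧ n 1 = a ^ 2 * (2 * B + 1) + a ∧
      n 2 = a ^ 2 * (2 * B + 1) ^ 2 + 1 :=
    ⟨![a ^ 2, a ^ 2 * (2 * B + 1) + a, a ^ 2 * (2 * B + 1) ^ 2 + 1], rfl, rfl, rfl⟩
  have hn : ‖Torus.latticeVec n‖ ≤ (a : ℝ) ^ 2 * P := hPn a n ha1 hn0 hn1 hn2
  refine ⟨n, ?_, ?_⟩
  · rw [goodDrifts, Set.mem_setOf_eq]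
    refine ⟨drift_ne_zero ha1 hn0, fun k hk hk0 => ?_, fun k hk0 hres => ?_⟩
    · -- uniform non-resonance of the stock
      have key := sq_div_two_le_abs_inner hB haB (hBk k hk) hk0 hn0 hn1 hn2
      calc 1 / (2 * M * P) * (‖Torus.latticeVec k‖ * ‖Torus.latticeVec n‖)
          ≤ 1 / (2 * M * P) * (M * ((a : ℝ) ^ 2 * P)) :=
            mul_le_mul_of_nonneg_left (mul_le_mul (hMk k hk) hn (norm_nonneg _) hM.le)
              (by positivity)
        _ = (a : ℝ) ^ 2 / 2 := by
            rw [mul_comm, mul_one_div, div_eq_div_iff (by positivity) (by norm_num)]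
            ring
        _ ≤ _ := key
    · -- well-rounded resonant sublattice
      have key := sq_div_four_le_norm_sq ha1 hk0 hn0 hn1 hn2 hres
      calc 1 / (4 * P) * ‖Torus.latticeVec n‖
          ≤ 1 / (4 * P) * ((a : ℝ) ^ 2 * P) := mul_le_mul_of_nonneg_left hn (by positivity)
        _ = (a : ℝ) ^ 2 / 4 := by
            rw [mul_comm, mul_one_div, div_eq_div_iff (by positivity) (by norm_num)]
            ring
        _ ≤ _ := key
  · -- arbitrarily large norm
    have h1 : (N : ℝ) ≤ (a : ℝ) := by exact_mod_cast haN
    have h2 : (1 : ℝ) ≤ a := by exact_mod_cast ha1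
    have h3 : (a : ℝ) ≤ (a : ℝ) ^ 2 := by nlinarith
    linarith [sq_le_norm_drift hn0]

end Summit.AnomalousDissipation.AnomalousDissipation.Theorems.DenseLoudDesignerForces.Galilean.GoodDrift

end
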